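import Summits.HodgeConjecture.HodgeConjecture.Cruxes.HLiu418.Lines.F0_P6a_PELSpread   -- the L4 HUB (sockets `stub_GSPREAD`; `stub_ELAWS` PAID BY TERM at its ED. 3): needed ONLY by the (ρ2) same-statement tie below (LEAD F0P6-plan «M-145e»)
import Summits.HodgeConjecture.HodgeConjecture.Theorems.F0P6aStubGEN   -- ★ p853316 (ρ1) TWIN (LAST part; part `…F0P6aStubGENZip` p853306 rides the import — custody edition p853415 (B44-N6): + ONE house-cap `set_option maxHeartbeats 400000 in` on `gen_of_parts'`, 0 declarations changed) of tree `Lines/F0_P6a_StubGEN.lean` 90d9fb611acd841e (505 l.; namespace KEPT)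
import HarnessLib
import HarnessLib.Audit.LibrarySuggestionsDenyListCruxes

/-! # F0_P6a_StubGEN — ED. 3a = SHIM (ED. 3 5bc4a825b3dc558b + ONE prose hunk for custody B44-N6; code bytes unchanged) (K6 P∕E column, LEAD F0P6-plan «M-142a» (B) ∕ «M-145d»; pen «L7» LA7-plan (g7), RE-HOME TABLE v1.7; box LAref-P (g5) first ∕ LA-ref1 (g5) second)

Every declaration of the previous edition (tree sha16 90d9fb611acd841e, 505 l., sorry-free; 12 declarations, e.g. `RecordGENChoicesCofinal`, `gen_of_parts'`, `stub_GEN`, `elaws_of_parts`, `heckeZip_holds`, `twistZip_holds`, `elaws_of_line`)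
now lives, byte for byte except the head՚s ONE-token type respelling (ρ1), the tie (ρ2) and — since custody edition p853415 (ops-buildfix B44-N6, house cap) — ONE `set_option maxHeartbeats 400000 in` line on `gen_of_parts'` (the tree original ran at the default budget; statement and proof bytes untouched) (module docstring → `/- … -/` archaeology comment; closed `[cite:]` letters carry `(print: …)` locators — gate relocation rule) and under the SAME namespace
`Summit.HodgeConjecture.HodgeConjecture.Cruxes.HLiu418.F0P6aStubGEN`, in ★ `Theorems/F0P6aStubGENZip.lean` (p853306; custody edition p853415) → ★ `Theorems/F0P6aStubGEN.lean` (p853316); this module keeps its name so that its tree importers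
(`F0_P6a_ModuliDatum.lean (MAIN :…, until MAIN՚s own ★ turn)` and any by-name reader under `open …F0P6aStubGEN`) resolve unchanged through the import above.
It declares nothing but the ONE `example` below — (ρ2): the SAME-STATEMENT TIE of tree ED. 2 :500–:501 lives here, hub-side, because it names the hub-only socket `F0P6aPELSpread.stub_ELAWS`;
(ρ1): the ★ head is spelled `elaws_of_line : …F0P6aPELSpread.RecordPELELawsCofinal` (ONE token for tree :497 `type_of% @…stub_ELAWS`; elaborated statement identical — the tie re-checks exactly that).  Nothing else was cut ⇒ nothing to alias.
ORDER NOTE: written on the LEAD՚s K6 shim-wave word together with the other shims of that wave; its `Lines` rev-closure by name (`F0_P6a_ModuliDatum`, `F0_D9opRoad2`, `F0_AlbCm`) re-makes in the same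
request (NO-CROSS-IMPORT: no environment may hold a `Lines/` ORIGINAL of this module together with its ★ twin); an importer smoke that reads «environment already contains …»
before that request is BUILT is this order note, not a defect.  Edition history stays in the line card and in git; future changes are ★-side proposals on the `Theorems/` files.
HC_CM is proved only modulo the 7 printed citations (2 remaining named inputs: hLiu418 = stmt-HodgeConjecture-24832, h413 = stmt-HodgeConjecture-24833) until rung 0 closes; count-neutral (0 `sorry`, 0 socket, 0 declarations). -/

/-- (ρ2) SAME-STATEMENT TIE (tree ED. 2 :500–:501, verbatim up to the FQN of the ★ head): elaborates iff ★ `F0P6aStubGEN.elaws_of_line` has EXACTLY the type of the hub socket `stub_ELAWS`; proof irrelevance. -/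
example : @Summit.HodgeConjecture.HodgeConjecture.Cruxes.HLiu418.F0P6aPELSpread.stub_ELAWS =
    @Summit.HodgeConjecture.HodgeConjecture.Cruxes.HLiu418.F0P6aStubGEN.elaws_of_line := rfl
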